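import Summits.CriticalPhenomena.PercolationContinuityZ3.Theorems.PercNearOneGluingNoHeavyPcintChordMemSound
import Summits.CriticalPhenomena.PercolationContinuityZ3.Theorems.PercNearOneGluingNoHeavyPcintNawRandMemSym
import HarnessLib

/-!
# PCINT lane, reduced-state B3r certificates: lattice symmetry and table certificates (bond)

Cell `prim-pcint` (PAPER-2 track (iii): certified intervals for `p_c(ℤ^d)`), seat `prim-pcint-2` (gen 4); support file
(`--supports stmt-CriticalPhenomena-4575`).  Does NOT build on p205010.  Companion of `…PcintChordMem` / `…PcintChordMemSound`
(the B3r automaton `chordMemAut τ` on dangerous-set states); bond twin of `…PcintNawRandMemSym` (prim-pcint-1 gen 5), whose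
generic pieces (`adj_smulSite_iff`, `nbrSites_smulSite`, `smulSite_apply_smulLetter_fst`, `simRel`) are reused.

* EQUIVARIANCE under the hyperoctahedral group (`SPerm d`): `bchord_smul`, `bgap_smul`, `bcorner_smul`, `bwt_smul`, hence
  `total_chordMemAut_smul` (totals are invariant) — a certificate may list ONE state per symmetry class.
* TABLE CERTIFICATES: rows `i : Fin N` carry a state `R i`, a weight `V i ≥ 1` and, per letter, either a rejection or a
  successor ROW together with the symmetry moving that row's state onto the true successor (`simRel`, with `mstep τ`).  The
  index automaton `btableAut` has the same totals as `chordMemAut` (`total_btableAut_eq`), and the Collatz–Wielandt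
  inequalities on the rows bound the totals geometrically (`total_chordMemAut_le_of_table`), whence
  `le_criticalProb_zd_of_chordMemTable : … → p ≤ p_c^bond(ℤ^d)`.
The kernel arithmetic that discharges these hypotheses from explicit integer data is in `…PcintChordMemKernel*`.
-/

noncomputable section

namespace Summit.CriticalPhenomena.PercolationContinuityZ3.Theorems.Pcint

open Finset Literature.Probability.Percolation Literature.Probability.LatticeModels

/-! ### Lattice symmetries: equivariance of the B3r automaton, invariance of totals -/

section SymB3r

variable {d : ℕ}

/-- The site action fixes the origin. [folklore] -/
theorem smulSite_zero (g : SPerm d) : smulSite g (0 : Site d) = 0 := by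
  ext i; simp [smulSite]

/-- **The detected chord set is equivariant.** [folklore] -/
theorem bchordSet_smul (g : SPerm d) (S : MState d) (a : Fin d × Bool) :
    bchordSet (smulState g S) (smulLetter g a) = (bchordSet S a).image fun q => (smulSite g q.1, q.2) := by
  ext q
  rw [bchordSet, bchordSet, mem_filter, mem_image, stepVec_smulLetter, mem_smulState]
  constructor
  · rintro ⟨⟨r, hr, hqr⟩, hadj⟩
    refine ⟨(r, q.2), mem_filter.2 ⟨hr, (adj_smulSite_iff g _ _).1 (by rw [← hqr]; exact hadj)⟩, ?_⟩
    rcases q with ⟨q1, q2⟩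
    simp only at hqr
    rw [hqr]
  · rintro ⟨q', hq', rfl⟩
    obtain ⟨hq'S, hadj⟩ := mem_filter.1 hq'
    exact ⟨⟨q'.1, by simpa using hq'S, rfl⟩, (adj_smulSite_iff g _ _).2 hadj⟩

/-- **The detected chord count is invariant.** [folklore] -/
theorem bchord_smul (g : SPerm d) (S : MState d) (a : Fin d × Bool) :
    bchord (smulState g S) (smulLetter g a) = bchord S a := by
  unfold bchord
  rw [bchordSet_smul, card_image_of_injective]
  rintro ⟨x, i⟩ ⟨y, j⟩ h
  simp only [Prod.mk.injEq] at h
  exact Prod.ext (smulSite_injective g h.1) h.2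

/-- **The detected gap set is equivariant.** [folklore] -/
theorem bgapSet_smul (g : SPerm d) (S : MState d) (a : Fin d × Bool) :
    bgapSet (smulState g S) (smulLetter g a) = (bgapSet S a).image (smulSite g) := by
  ext w
  rw [bgapSet, bgapSet, mem_filter, mem_image, stepVec_smulLetter, nbrSites_smulSite, mem_image]
  constructor
  · rintro ⟨⟨w', hw', rfl⟩, hw0, hnot, q, hq, hq2, hadj⟩
    obtain ⟨r, hr, hqr⟩ := (mem_smulState g S q).1 hq
    refine ⟨w', mem_filter.2 ⟨hw', fun h => hw0 (by rw [h, smulSite_zero]), fun q' hq' hq'w => ?_, (r, q.2), hr, hq2,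
      (adj_smulSite_iff g _ _).1 (by rw [← hqr]; exact hadj)⟩, rfl⟩
    exact hnot (smulSite g q'.1, q'.2) ((mem_smulState g S _).2 ⟨q'.1, by simpa using hq', rfl⟩) (by rw [hq'w])
  · rintro ⟨w', hw', rfl⟩
    obtain ⟨hw'n, hw0, hnot, q, hq, hq2, hadj⟩ := mem_filter.1 hw'
    refine ⟨⟨w', hw'n, rfl⟩, fun h => hw0 (smulSite_injective g (by rw [h, smulSite_zero])), fun q' hq' hq'w => ?_,
      (smulSite g q.1, q.2), (mem_smulState g S _).2 ⟨q.1, by simpa using hq, rfl⟩, hq2, (adj_smulSite_iff g _ _).2 hadj⟩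
    obtain ⟨r, hr, hqr⟩ := (mem_smulState g S q').1 hq'
    exact hnot (r, q'.2) hr (smulSite_injective g (by rw [← hqr, hq'w]))

/-- **The detected gap count is invariant.** [folklore] -/
theorem bgap_smul (g : SPerm d) (S : MState d) (a : Fin d × Bool) :
    bgap (smulState g S) (smulLetter g a) = bgap S a := by
  unfold bgap
  rw [bgapSet_smul, card_image_of_injective _ (smulSite_injective g)]

/-- **The claimed corner is invariant.** [folklore] -/
theorem bcorner_smul (g : SPerm d) (S : MState d) (a : Fin d × Bool) :
    bcorner (smulState g S) (smulLetter g a) = bcorner S a := by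
  unfold bcorner
  rw [Bool.eq_iff_iff, decide_eq_true_iff, decide_eq_true_iff]
  constructor
  · rintro ⟨q₁, hq₁, h1, hperp, hnot, hfree⟩
    obtain ⟨r₁, hr₁, hqr₁⟩ := (mem_smulState g S q₁).1 hq₁
    rw [h1] at hr₁
    refine ⟨(r₁, 1), hr₁, rfl, (smulSite_apply_smulLetter_fst g r₁ a).1 (by rw [← hqr₁]; exact hperp), ?_, ?_⟩
    · intro q hq hqe
      refine hnot (smulSite g q.1, q.2) ((mem_smulState g S _).2 ⟨q.1, by simpa using hq, rfl⟩) ?_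
      simp only
      rw [hqe, smulSite_add, hqr₁, stepVec_smulLetter]
    · intro q hq hq2 hadj
      refine hfree (smulSite g q.1, q.2) ((mem_smulState g S _).2 ⟨q.1, by simpa using hq, rfl⟩) hq2 ?_
      rw [hqr₁, stepVec_smulLetter, ← smulSite_add]
      exact (adj_smulSite_iff g _ _).2 hadj
  · rintro ⟨q₁, hq₁, h1, hperp, hnot, hfree⟩
    refine ⟨(smulSite g q₁.1, 1), (mem_smulState g S _).2 ⟨q₁.1, ?_, rfl⟩, rfl,
      (smulSite_apply_smulLetter_fst g q₁.1 a).2 hperp, ?_, ?_⟩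
    · rw [← h1]; simpa using hq₁
    · intro q hq hqe
      obtain ⟨r, hr, hqr⟩ := (mem_smulState g S q).1 hq
      refine hnot (r, q.2) hr (smulSite_injective g ?_)
      simp only at hqe ⊢
      rw [← hqr, hqe, smulSite_add, stepVec_smulLetter]
    · intro q hq hq2 hadj
      obtain ⟨r, hr, hqr⟩ := (mem_smulState g S q).1 hq
      refine hfree (r, q.2) hr hq2 ((adj_smulSite_iff g _ _).1 ?_)
      rw [smulSite_add, ← stepVec_smulLetter, ← hqr]
      exact hadj

/-- **The step factor is invariant.** [folklore] -/
theorem bwt_smul (cr sb κb : ℝ) (g : SPerm d) (S : MState d) (a : Fin d × Bool) :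
    bwt cr sb κb (smulState g S) (smulLetter g a) = bwt cr sb κb S a := by
  unfold bwt; rw [bchord_smul, bgap_smul, bcorner_smul]

/-- Row sums of `chordMemAut` against an invariant function are invariant. [folklore] -/
theorem stepSum_chordMemAut_smul {τ : ℕ} {p cr sb κb : ℝ} (hp : 0 ≤ p) (hcr : 0 ≤ cr) (hsb : 0 ≤ sb) (hκb : 0 ≤ κb)
    (g : SPerm d) {f : MState d → ℝ} (hf : ∀ T, f (smulState g T) = f T) (S : MState d) :
    (chordMemAut τ p cr sb κb hp hcr hsb hκb).stepSum f (smulState g S) =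
      (chordMemAut τ p cr sb κb hp hcr hsb hκb).stepSum f S := by
  unfold WAut.stepSum
  rw [← Equiv.sum_comp (letterEquiv g)]
  refine Finset.sum_congr rfl fun a _ => ?_
  have h1 : (chordMemAut τ p cr sb κb hp hcr hsb hκb).step (smulState g S) (letterEquiv g a) =
      ((chordMemAut τ p cr sb κb hp hcr hsb hκb).step S a).map (smulState g) := mstep_smul τ g S a
  have h2 : (chordMemAut τ p cr sb κb hp hcr hsb hκb).wt (smulState g S) (letterEquiv g a) =
      (chordMemAut τ p cr sb κb hp hcr hsb hκb).wt S a := by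
    show p * bwt cr sb κb (smulState g S) (smulLetter g a) = p * bwt cr sb κb S a
    rw [bwt_smul]
  rw [h1, h2]
  cases (chordMemAut τ p cr sb κb hp hcr hsb hκb).step S a with
  | none => rfl
  | some T => simp only [Option.map_some, hf]

/-- **Totals of the B3r automaton are invariant under lattice symmetries.** [folklore] -/
theorem total_chordMemAut_smul {τ : ℕ} {p cr sb κb : ℝ} (hp : 0 ≤ p) (hcr : 0 ≤ cr) (hsb : 0 ≤ sb) (hκb : 0 ≤ κb)
    (g : SPerm d) : ∀ (n : ℕ) (S : MState d),
      (chordMemAut τ p cr sb κb hp hcr hsb hκb).total n (smulState g S) =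
        (chordMemAut τ p cr sb κb hp hcr hsb hκb).total n S := by
  intro n
  induction n with
  | zero => intro S; rw [WAut.total_zero, WAut.total_zero]
  | succ n ih =>
    intro S
    rw [WAut.total_succ, WAut.total_succ]
    exact stepSum_chordMemAut_smul hp hcr hsb hκb g (fun T => ih T) S

end SymB3r

/-! ### Table certificates modulo symmetry: a finite index automaton simulating `chordMemAut` -/

section Table

variable {d N : ℕ}

/-- The INDEX AUTOMATON of a bond table: states are row indices, transitions are read off the table, weights are
recomputed from the row's state. [folklore] -/
def btableAut (τ : ℕ) (p cr sb κb : ℝ) (hp : 0 ≤ p) (hcr : 0 ≤ cr) (hsb : 0 ≤ sb) (hκb : 0 ≤ κb)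
    (R : Fin N → MState d) (sc : Fin N → Fin d × Bool → Option (Fin N × SPerm d)) : WAut (Fin N) (Fin d × Bool) where
  step i a := (sc i a).map Prod.fst
  wt i a := (chordMemAut τ p cr sb κb hp hcr hsb hκb).wt (R i) a
  wt_nonneg i a := (chordMemAut τ p cr sb κb hp hcr hsb hκb).wt_nonneg (R i) a

/-- **Simulation**: the index automaton of a table in simulation with `chordMemAut` has the same totals. [folklore] -/
theorem total_btableAut_eq {τ : ℕ} {p cr sb κb : ℝ} (hp : 0 ≤ p) (hcr : 0 ≤ cr) (hsb : 0 ≤ sb) (hκb : 0 ≤ κb)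
    (R : Fin N → MState d) (sc : Fin N → Fin d × Bool → Option (Fin N × SPerm d))
    (hsim : ∀ i a, simRel R (mstep τ (R i) a) (sc i a) = true) :
    ∀ (n : ℕ) (i : Fin N), (btableAut τ p cr sb κb hp hcr hsb hκb R sc).total n i =
      (chordMemAut τ p cr sb κb hp hcr hsb hκb).total n (R i) := by
  intro n
  induction n with
  | zero => intro i; rw [WAut.total_zero, WAut.total_zero]
  | succ n ih =>
    intro i
    rw [WAut.total_succ, WAut.total_succ]
    unfold WAut.stepSum
    refine Finset.sum_congr rfl fun a _ => ?_
    have h := hsim i a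
    have e1 : (btableAut τ p cr sb κb hp hcr hsb hκb R sc).step i a = (sc i a).map Prod.fst := rfl
    have e2 : (chordMemAut τ p cr sb κb hp hcr hsb hκb).step (R i) a = mstep τ (R i) a := rfl
    rw [e1, e2]
    revert h
    generalize mstep τ (R i) a = oT
    generalize sc i a = oJ
    intro h
    cases oT with
    | none =>
      cases oJ with
      | none => rfl
      | some jg => exact absurd h (by simp [simRel])
    | some T =>
      cases oJ with
      | none => exact absurd h (by simp [simRel])
      | some jg =>
        have hT : T = smulState jg.2 (R jg.1) := by simpa [simRel] using h
        simp only [Option.map_some]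
        rw [ih jg.1, hT, total_chordMemAut_smul]
        rfl

/-- **Table certificate ⇒ geometric bound on the totals of `chordMemAut`.**  If the rows carry states `R i`, positive
weights `V i ≥ 1`, successor data in simulation with `mstep`, and satisfy the Collatz–Wielandt inequalities
`Σ_a p·bwt(R i,a)·V(succ) ≤ λ V i`, then `total n (R i) ≤ λⁿ V i` for every row. [folklore] -/
theorem total_chordMemAut_le_of_table {τ : ℕ} {p cr sb κb lam : ℝ} (hp : 0 ≤ p) (hcr : 0 ≤ cr) (hsb : 0 ≤ sb)
    (hκb : 0 ≤ κb) (hlam : 0 ≤ lam) (R : Fin N → MState d) (sc : Fin N → Fin d × Bool → Option (Fin N × SPerm d))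
    (V : Fin N → ℝ) (hV : ∀ i, 1 ≤ V i) (hsim : ∀ i a, simRel R (mstep τ (R i) a) (sc i a) = true)
    (hcw : ∀ i, (∑ a : Fin d × Bool, match sc i a with
      | none => 0
      | some jg => p * bwt cr sb κb (R i) a * V jg.1) ≤ lam * V i) (n : ℕ) (i : Fin N) :
    (chordMemAut τ p cr sb κb hp hcr hsb hκb).total n (R i) ≤ lam ^ n * V i := by
  rw [← total_btableAut_eq hp hcr hsb hκb R sc hsim n i]
  have hcw' : ∀ i, (btableAut τ p cr sb κb hp hcr hsb hκb R sc).stepSum V i ≤ lam * V i := fun i => by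
    refine le_of_eq_of_le ?_ (hcw i)
    unfold WAut.stepSum
    refine Finset.sum_congr rfl fun a _ => ?_
    have e1 : (btableAut τ p cr sb κb hp hcr hsb hκb R sc).step i a = (sc i a).map Prod.fst := rfl
    rw [e1]
    cases sc i a with
    | none => rfl
    | some jg => rfl
  have := (btableAut τ p cr sb κb hp hcr hsb hκb R sc).total_le_of_cw one_pos hV hlam hcw' n i
  rwa [div_one] at this

/-- **Reduced-state B3r certificate (table form) ⇒ `p ≤ p_c^bond(ℤ^d)`.**  The row `i₀` with the empty state gives the bound
on the totals from `∅` needed by `le_criticalProb_zd_of_chordMem_total`.  Constants: `0 < s̄ ≤ 1` with `s̄² ≥ 1 - p²`,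
`(1+s̄)/2 ≤ κ̄`, refund `r ≥ 0` with `s̄·r ≥ 1` and `(1-p)·r ≤ 1` (the automaton's chord factor is `cr = (1-p)·r`). [folklore] -/
theorem le_criticalProb_zd_of_chordMemTable [NeZero d] {τ : ℕ} (hτ : 2 ≤ τ) (p : unitInterval)
    {sb κb r lam : ℝ} (hs0 : 0 < sb) (hsb1 : sb ≤ 1) (hκb : (1 + sb) / 2 ≤ κb) (hps : 1 - (p : ℝ) ^ 2 ≤ sb ^ 2)
    (hr0 : 0 ≤ r) (hsr : 1 ≤ sb * r) (hpr : (1 - (p : ℝ)) * r ≤ 1) (hlam0 : 0 ≤ lam) (hlam1 : lam < 1)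
    (R : Fin N → MState d) (sc : Fin N → Fin d × Bool → Option (Fin N × SPerm d)) (V : Fin N → ℝ)
    (i₀ : Fin N) (h0 : R i₀ = ∅) (hV : ∀ i, 1 ≤ V i) (hsim : ∀ i a, simRel R (mstep τ (R i) a) (sc i a) = true)
    (hcw : ∀ i, (∑ a : Fin d × Bool, match sc i a with
      | none => 0
      | some jg => (p : ℝ) * bwt ((1 - p) * r) sb κb (R i) a * V jg.1) ≤ lam * V i) :
    (p : ℝ) ≤ criticalProb (zdGraph d) 0 := by
  refine le_criticalProb_zd_of_chordMem_total hτ p hs0 le_rfl hsb1 hκb hps hr0 hsr hpr hlam0 hlam1 (C := V i₀)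
    fun n => ?_
  have h := total_chordMemAut_le_of_table p.2.1 (mul_nonneg (sub_nonneg.2 p.2.2) hr0) hs0.le (by linarith) hlam0 R sc
    V hV hsim hcw n i₀
  rw [h0] at h
  exact h.trans_eq (mul_comm _ _)

end Table

end Summit.CriticalPhenomena.PercolationContinuityZ3.Theorems.Pcint
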